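import Summits.HodgeConjecture.HodgeConjecture.Theorems.TropicalKugaSatakeCayleyFormalCycleCriterionFormalFamilyLinAlg
import Literature.AlgebraicGeometry.Tropical.KugaSatakeLinearFamily
import HarnessLib

/-!
# Crux `FormalCycleCriterion` (stmt-HodgeConjecture-18571), line `birth` — registered stub 1
# `stub_formalFamily`, PROVED: Kontsevich's formal cycle

Route `TropicalKugaSatakeCayley` of `HodgeConjecture`. Stub 1 of the registered skeleton
`Cruxes/FormalCycleCriterion/Lines/birth.lean`: at a parameter `t ∈ ksPosCone` with `ℚ`-linearly
independent coordinates, an effective framed simplicial `2`-cycle `Z` of `ℝ⁸ / B_t ℤ⁸`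
(`B_t = ksMatrix t`) is the member `t' = t` of a family of framed chains over an open preconnected
`U ∋ t`, `U ⊆ ksPosCone`, with the same direction frames and weights, in which every incidence of `Z`
at `t` (two ordered faces being `B_t ℤ⁸`-translates) persists as the corresponding incidence at `t'`
(w.r.t. `B_{t'} ℤ⁸`), every member is effective, and the period class moves continuously.

Proof (`formalFamily`; Zharkov p. 3, "cycles which vary rationally over the space of parameters").
1. THE SYSTEM. The vertices of the cells are rational linear functions of the data vector
   `x = (base_c, coef_c)_c` (`exists_vertexCoeff`: the direction frames are rational), and
   `B_{t'} k` is an integral linear function of `t'` (`exists_periodCoeff`). Choosing one period vector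
   `k` for every incidence of `Z` at `t`, the incidences read `M x = N t'` with `M` rational, `N`
   integral, solved at `t' = t` by the data of `Z`.
2. GENERICITY. `t` has `ℚ`-linearly independent coordinates, so with a generalized inverse `G` of
   `M` the affine section `x(t') = x_Z + G N (t' − t)` solves the system for EVERY `t'`
   (`mulVec_section_of_linearIndependent`, lemmas file): all incidences persist, with the same `k`.
3. THE OPEN SET. `ksPosCone` is open (`isOpen_ksPosCone`: minimum of the quadratic form on the unit
   sphere + tube lemma) and effectivity `weight · det coef > 0` is an open condition along the
   continuous section, so a ball `U` around `t` works; the period class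
   `compound 2 (B_{t'})⁻¹ · classOf` is continuous on `U` (matrix inversion at invertible matrices,
   minors and determinants are polynomial).

No named fact, no new definition, no sorry. The last theorem has the REGISTERED SIGNATURE VERBATIM.
References: [Zharkov2020TropicalWeil] I. Zharkov, Tropical abelian varieties, Weil classes and the
Hodge conjecture, arXiv:2002.02347, p. 3; [MikhalkinZharkov2014Eigenwave] G. Mikhalkin, I. Zharkov,
Tropical eigenwave and intermediate Jacobians, LN UMI 15 (2014), Def. 4.2.
-/

noncomputable section

-- `Summit.HodgeConjecture.HodgeConjecture.…` is the mandated namespace (single-conjunct summit).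
set_option linter.dupNamespace false

open scoped BigOperators
open Matrix

namespace Summit.HodgeConjecture.HodgeConjecture.Theorems.FormalCycleCriterion

open Literature.AlgebraicGeometry.Tropical
open Literature.AlgebraicGeometry.Tropical.TropicalTorus

/-! ### The linear system of a framed chain: vertices and periods as rational matrices -/

section System

variable {n g : ℕ}

/-- **The vertices are rational linear functions of the cell data.** There are rational
coefficient vectors `V c j r` on the data space `x = (base_c, coef_c)_c` (indexed by
`Fin n × (Fin g ⊕ Fin 2 × Fin 2)`) such that `⟪V c j r, x⟫` is the `r`-th coordinate of the `j`-th
vertex of the cell `c` with base `x(c, ·)`, direction frame `D c` and coefficients `x(c, ·, ·)`.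
[folklore] -/
theorem exists_vertexCoeff (D : Fin n → Matrix (Fin g) (Fin 2) ℚ) (w : Fin n → ℚ) :
    ∃ V : Fin n → Fin 3 → Fin g → (Fin n × (Fin g ⊕ Fin 2 × Fin 2)) → ℚ,
      ∀ (x : Fin n × (Fin g ⊕ Fin 2 × Fin 2) → ℝ) (c : Fin n) (j : Fin 3) (r : Fin g),
        ∑ κ, (V c j r κ : ℝ) * x κ =
          (⟨fun r => x (c, Sum.inl r), D c, Matrix.of fun i l => x (c, Sum.inr (i, l)), w c⟩ :
            Cell ℝ g 2).vertex j r := by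
  classical
  refine ⟨fun c j r κ => if κ.1 = c then
      Sum.elim (fun r' => if r' = r then (1 : ℚ) else 0)
        (fun il => if j = il.1.succ then D c r il.2 else 0) κ.2 else 0, ?_⟩
  intro x c j r
  rw [Fintype.sum_prod_type, Finset.sum_eq_single c (fun c' _ hc' => by simp [hc']) (by simp)]
  simp only [if_true, Fintype.sum_sum_type, Sum.elim_inl, Sum.elim_inr, Fintype.sum_prod_type]
  have h1 : ∑ r' : Fin g, ((if r' = r then (1 : ℚ) else 0 : ℚ) : ℝ) * x (c, Sum.inl r') =
      x (c, Sum.inl r) := by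
    rw [Finset.sum_eq_single r (fun r' _ hr' => by simp [hr']) (by simp)]
    simp
  rw [h1]
  refine Fin.cases ?_ (fun i => ?_) j
  · -- the base vertex
    simp [Cell.vertex]
  · -- the vertex `base + edge i`
    simp only [Cell.vertex, Fin.cases_succ, Pi.add_apply, Cell.edge, Matrix.of_apply,
      Fin.succ_inj, eq_ratCast]
    congr 1
    rw [Finset.sum_eq_single i (fun i' _ hi' => by simp [Ne.symm hi']) (by simp)]
    simp

/-- **The periods are integer linear functions of the parameter.** For integer vectors `k e`,
`(B_v · k e)_r = Σ_s N e r s · v s` with `N e r s = (ksForm s · k e)_r ∈ ℤ`, `B_v = ksMatrix v`.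
[folklore] -/
theorem exists_periodCoeff {ι : Type*} (k : ι → Fin 8 → ℤ) :
    ∃ N : ι → Fin 8 → Fin 5 → ℚ, ∀ (v : Fin 5 → ℝ) (e : ι) (r : Fin 8),
      ∑ s, (N e r s : ℝ) * v s = (ksMatrix v).mulVec (fun q => (k e q : ℝ)) r := by
  refine ⟨fun e r s => (((ksForm s).mulVec (k e)) r : ℤ), fun v e r => ?_⟩
  simp only [ksMatrix, Matrix.mulVec, dotProduct, Matrix.sum_apply, Matrix.smul_apply,
    Matrix.map_apply, smul_eq_mul, Finset.sum_mul]
  rw [Finset.sum_comm]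
  refine Finset.sum_congr rfl fun s _ => ?_
  push_cast
  rw [Finset.sum_mul]
  refine Finset.sum_congr rfl fun q _ => ?_
  ring

/-- The family `v ↦ B_v = ksMatrix v` is continuous (it is linear). [folklore] -/
theorem continuous_ksMatrix : Continuous fun v : Fin 5 → ℝ => ksMatrix v := by
  refine continuous_matrix fun i j => ?_
  simp only [ksMatrix, Matrix.sum_apply, Matrix.smul_apply, Matrix.map_apply, smul_eq_mul]
  exact continuous_finsetSum _ fun s _ => (continuous_apply s).mul continuous_const

/-- Every `B_v` is symmetric. [folklore] -/
theorem isHermitian_ksMatrix (v : Fin 5 → ℝ) : (ksMatrix v).IsHermitian := by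
  rw [Matrix.isHermitian_iff_isSymm]
  show (ksMatrix v).transpose = ksMatrix v
  simp only [ksMatrix, Matrix.transpose_sum, Matrix.transpose_smul]
  refine Finset.sum_congr rfl fun i _ => ?_
  rw [← Matrix.transpose_map, ksForm_transpose]

/-- **The positive cone `ksPosCone` is open.** [folklore] -/
theorem isOpen_ksPosCone : IsOpen ksPosCone :=
  isOpen_setOf_posDef ksMatrix (fun i j => (continuous_ksMatrix.matrix_elem i j))
    isHermitian_ksMatrix

/-- `v ↦ A · (G · v)`-type maps are continuous: multiplication by a fixed real matrix.
[folklore] -/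
theorem continuous_mulVec_const {ι κ : Type*} [Fintype ι] [Fintype κ] (A : Matrix ι κ ℝ) :
    Continuous fun v : κ → ℝ => A.mulVec v := by
  refine continuous_pi fun i => ?_
  simp only [Matrix.mulVec, dotProduct]
  exact continuous_finsetSum _ fun j _ => continuous_const.mul (continuous_apply j)

/-- `A ↦ compound 2 A` is continuous (minors are polynomials). [folklore] -/
theorem continuous_compound_two : Continuous fun A : Matrix (Fin g) (Fin g) ℝ => compound 2 A := by
  refine continuous_matrix fun K I => ?_
  show Continuous fun A : Matrix (Fin g) (Fin g) ℝ =>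
    (A.submatrix (K.1.orderEmbOfFin K.2) (I.1.orderEmbOfFin I.2)).det
  exact (continuous_id.matrix_submatrix _ _).matrix_det

end System

/-! ### The formal family -/

section Family

open Classical in
/-- **Kontsevich's formal cycle through an effective tropical chain at a `ℚ`-generic parameter**
(general form of the registered stub; the cycle condition is not needed for the construction). The incidences of `Z` at `t` ("ordered face `(c', i', π')`
is the `B_t ℤ⁸`-translate by `B_t k` of ordered face `(c, i, π)`") form a linear system
`M x = N t` in the cell data `x = (base_c, coef_c)_c` with `M` rational (the direction frames are
rational) and `N` integral (`N t' = (B_{t'} k)`); it is solvable at the `ℚ`-generic `t`, hence at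
every `t'` (`mulVec_section_of_linearIndependent`), by the affine section
`x(t') = x_Z + G N (t' - t)`. The cells built from `x(t')` keep the direction frames and weights,
satisfy every old incidence w.r.t. `B_{t'} ℤ⁸`, are effective near `t` (the determinants move
continuously) and have a continuous period class; `U` is a small ball around `t` inside the open
positive cone. [cite: Zharkov2020TropicalWeil, p. 3] [cite: MikhalkinZharkov2014Eigenwave, Def. 4.2] -/
theorem formalFamily (t : Fin 5 → ℝ) (ht : t ∈ ksPosCone) (hli : LinearIndependent ℚ t)
    (Z : Chain ℝ 8 2) (hZe : Z.Effective) :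
    ∃ U : Set (Fin 5 → ℝ), IsOpen U ∧ IsPreconnected U ∧ t ∈ U ∧ U ⊆ ksPosCone ∧
      ∃ cell : (Fin 5 → ℝ) → Fin Z.size → Cell ℝ 8 2,
        cell t = Z.cell ∧
        (∀ t' c, (cell t' c).dir = (Z.cell c).dir ∧ (cell t' c).weight = (Z.cell c).weight) ∧
        (∀ t' ∈ U, ∀ (c c' : Fin Z.size) (i i' : Fin 3) (π π' : Equiv.Perm (Fin 2)),
          IsTranslate (ksMatrix t) ((Z.cell c).face i ∘ π) ((Z.cell c').face i' ∘ π') →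
            IsTranslate (ksMatrix t') ((cell t' c).face i ∘ π) ((cell t' c').face i' ∘ π')) ∧
        (∀ t' ∈ U, (⟨Z.size, cell t'⟩ : Chain ℝ 8 2).Effective) ∧
        ContinuousOn (fun t' => compound 2 (ksMatrix t')⁻¹ *
          (⟨Z.size, cell t'⟩ : Chain ℝ 8 2).classOf) U := by
  classical
  -- the incidences of `Z` at `t` and their period vectors `k`
  let S : Finset ((Fin Z.size × Fin Z.size) × (Fin 3 × Fin 3) ×
      (Equiv.Perm (Fin 2) × Equiv.Perm (Fin 2))) :=
    Finset.univ.filter fun q => IsTranslate (ksMatrix t)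
      ((Z.cell q.1.1).face q.2.1.1 ∘ q.2.2.1) ((Z.cell q.1.2).face q.2.1.2 ∘ q.2.2.2)
  have hkex : ∀ q : S, ∃ kq : Fin 8 → ℤ, ∀ j,
      ((Z.cell q.1.1.2).face q.1.2.1.2 ∘ q.1.2.2.2) j =
        ((Z.cell q.1.1.1).face q.1.2.1.1 ∘ q.1.2.2.1) j +
          (ksMatrix t).mulVec (fun r => (kq r : ℝ)) :=
    fun q => (Finset.mem_filter.1 q.2).2
  choose k hk using hkex
  -- cells from data vectors `x = (base_c, coef_c)_c`
  let mk : (Fin Z.size × (Fin 8 ⊕ Fin 2 × Fin 2) → ℝ) → Fin Z.size → Cell ℝ 8 2 := fun x c =>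
    ⟨fun r => x (c, Sum.inl r), (Z.cell c).dir, Matrix.of fun i l => x (c, Sum.inr (i, l)),
      (Z.cell c).weight⟩
  let x₀ : Fin Z.size × (Fin 8 ⊕ Fin 2 × Fin 2) → ℝ := fun κ =>
    Sum.elim (fun r => (Z.cell κ.1).base r) (fun il => (Z.cell κ.1).coef il.1 il.2) κ.2
  have hmk₀ : mk x₀ = Z.cell := by
    funext c
    rfl
  -- the rational matrices of the incidence system `M x = N t'`
  obtain ⟨V, hV⟩ := exists_vertexCoeff (n := Z.size) (g := 8) (fun c => (Z.cell c).dir)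
    (fun c => (Z.cell c).weight)
  obtain ⟨Nc, hNc⟩ := exists_periodCoeff k
  let M : Matrix (S × Fin 2 × Fin 8) (Fin Z.size × (Fin 8 ⊕ Fin 2 × Fin 2)) ℚ :=
    Matrix.of fun e κ =>
      V e.1.1.1.2 (e.1.1.2.1.2.succAbove (e.1.1.2.2.2 e.2.1)) e.2.2 κ -
        V e.1.1.1.1 (e.1.1.2.1.1.succAbove (e.1.1.2.2.1 e.2.1)) e.2.2 κ
  let N : Matrix (S × Fin 2 × Fin 8) (Fin 5) ℚ := Matrix.of fun e s => Nc e.1 e.2.2 s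
  have hMx : ∀ (x : Fin Z.size × (Fin 8 ⊕ Fin 2 × Fin 2) → ℝ) (q : S) (j : Fin 2) (r : Fin 8),
      (M.map ((↑) : ℚ → ℝ)).mulVec x (q, j, r) =
        ((mk x q.1.1.2).face q.1.2.1.2 ∘ q.1.2.2.2) j r -
          ((mk x q.1.1.1).face q.1.2.1.1 ∘ q.1.2.2.1) j r := by
    intro x q j r
    simp only [Matrix.mulVec, dotProduct, Matrix.map_apply, Matrix.of_apply, M, Rat.cast_sub,
      sub_mul, Finset.sum_sub_distrib, hV]
    rfl
  have hNx : ∀ (v : Fin 5 → ℝ) (q : S) (j : Fin 2) (r : Fin 8),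
      (N.map ((↑) : ℚ → ℝ)).mulVec v (q, j, r) = (ksMatrix v).mulVec (fun r => (k q r : ℝ)) r := by
    intro v q j r
    simp only [Matrix.mulVec, dotProduct, Matrix.map_apply, Matrix.of_apply, N]
    exact hNc v q r
  -- the system holds at `t` for the data of `Z`
  have hx₀ : (M.map ((↑) : ℚ → ℝ)).mulVec x₀ = (N.map ((↑) : ℚ → ℝ)).mulVec t := by
    funext e
    obtain ⟨q, j, r⟩ := e
    rw [hMx, hNx, hmk₀]
    have h := congr_fun (hk q j) r
    simp only [Pi.add_apply] at h
    linarith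
  obtain ⟨G, hG⟩ := exists_generalizedInverse M
  -- the affine section and the family of cells
  let x : (Fin 5 → ℝ) → Fin Z.size × (Fin 8 ⊕ Fin 2 × Fin 2) → ℝ := fun t' =>
    x₀ + (G.map ((↑) : ℚ → ℝ)).mulVec ((N.map ((↑) : ℚ → ℝ)).mulVec (t' - t))
  have hsol : ∀ t', (M.map ((↑) : ℚ → ℝ)).mulVec (x t') = (N.map ((↑) : ℚ → ℝ)).mulVec t' := by
    intro t'
    show (M.map _).mulVec (x₀ + (G.map _).mulVec ((N.map _).mulVec (t' - t))) = _
    rw [Matrix.mulVec_add, hx₀, Matrix.mulVec_sub, Matrix.mulVec_sub, Matrix.mulVec_sub,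
      mulVec_section_of_linearIndependent M G hG N t hli x₀ hx₀ t',
      mulVec_section_of_linearIndependent M G hG N t hli x₀ hx₀ t]
    abel
  have hxt : x t = x₀ := by
    simp only [x, sub_self, Matrix.mulVec_zero, add_zero]
  have hxc : Continuous x :=
    continuous_const.add ((continuous_mulVec_const _).comp
      ((continuous_mulVec_const _).comp (continuous_id.sub continuous_const)))
  have hdetc : ∀ c : Fin Z.size, Continuous fun t' =>
      (Matrix.of fun i l => x t' (c, Sum.inr (i, l)) : Matrix (Fin 2) (Fin 2) ℝ).det :=
    fun c => (continuous_matrix fun i l =>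
      (continuous_apply (c, Sum.inr (i, l))).comp hxc).matrix_det
  -- the open set: a ball around `t` inside the positive cone and the effectivity locus
  have hO : IsOpen (ksPosCone ∩ {t' | ∀ c : Fin Z.size, 0 < ((Z.cell c).weight : ℝ) *
      (Matrix.of fun i l => x t' (c, Sum.inr (i, l)) : Matrix (Fin 2) (Fin 2) ℝ).det}) := by
    refine isOpen_ksPosCone.inter ?_
    rw [Set.setOf_forall]
    exact isOpen_iInter_of_finite fun c => isOpen_lt continuous_const (continuous_const.mul (hdetc c))
  have htE : t ∈ ksPosCone ∩ {t' | ∀ c : Fin Z.size, 0 < ((Z.cell c).weight : ℝ) *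
      (Matrix.of fun i l => x t' (c, Sum.inr (i, l)) : Matrix (Fin 2) (Fin 2) ℝ).det} := by
    refine ⟨ht, fun c => ?_⟩
    rw [hxt]
    exact hZe c
  obtain ⟨ε, hε, hball⟩ := Metric.isOpen_iff.1 hO t htE
  refine ⟨Metric.ball t ε, Metric.isOpen_ball, (convex_ball t ε).isPreconnected,
    Metric.mem_ball_self hε, fun t' ht' => (hball ht').1, fun t' => mk (x t'), ?_, ?_, ?_, ?_, ?_⟩
  · -- the member at `t` is `Z`
    show mk (x t) = Z.cell
    rw [hxt, hmk₀]
  · -- direction frames and weights are kept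
    exact fun t' c => ⟨rfl, rfl⟩
  · -- every old incidence persists, with the same integer vector
    intro t' _ c c' i i' π π' hinc
    let q : S := ⟨((c, c'), (i, i'), (π, π')), Finset.mem_filter.2 ⟨Finset.mem_univ _, hinc⟩⟩
    refine ⟨k q, fun j => ?_⟩
    funext r
    have h := congr_fun (hsol t') (q, j, r)
    rw [hMx, hNx] at h
    have h' : ((mk (x t') c').face i' ∘ π') j r - ((mk (x t') c).face i ∘ π) j r =
        (ksMatrix t').mulVec (fun r => (k q r : ℝ)) r := h
    rw [Pi.add_apply]
    linarith
  · -- effectivity on the ball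
    intro t' ht'
    exact (hball ht').2
  · -- continuity of the period class on the ball
    intro t' ht'
    have hpd : (ksMatrix t').PosDef := (hball ht').1
    have hinv : ContinuousAt (fun t'' => (ksMatrix t'')⁻¹) t' := by
      refine (continuousAt_matrix_inv (ksMatrix t') ?_).comp continuous_ksMatrix.continuousAt
      rw [Ring.inverse_eq_inv']
      exact continuousAt_inv₀ hpd.det_pos.ne'
    have hcomp : ContinuousAt (fun t'' => compound 2 (ksMatrix t'')⁻¹) t' :=
      continuous_compound_two.continuousAt.comp hinv
    have hcls : Continuous fun t'' => (⟨Z.size, mk (x t'')⟩ : Chain ℝ 8 2).classOf := by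
      show Continuous fun t'' => ∑ c : Fin Z.size, (mk (x t'') c).classOf
      refine continuous_finsetSum _ fun c _ => continuous_matrix fun K J => ?_
      show Continuous fun t'' => algebraMap ℚ ℝ (((Nat.factorial 2 : ℚ)⁻¹ *
        pluecker (Z.cell c).dir K) * ((Z.cell c).weight * pluecker (Z.cell c).dir J)) *
          (Matrix.of fun i l => x t'' (c, Sum.inr (i, l)) : Matrix (Fin 2) (Fin 2) ℝ).det
      exact continuous_const.mul (hdetc c)
    exact (hcomp.mul hcls.continuousAt).continuousWithinAt

end Family

/-- **Registered stub `stub_formalFamily` of the line `birth`** (crux `FormalCycleCriterion`,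
stmt-HodgeConjecture-18571), verbatim — Kontsevich's formal cycle: at a parameter `t ∈ ksPosCone`
with `ℚ`-linearly independent coordinates, an effective tropical `2`-cycle `Z` of `ℝ⁸ / B_t ℤ⁸`
is the member `t' = t` of a family of framed chains over an open preconnected `U ∋ t` inside the
cone, with the same direction frames and weights, along which every `B_t`-incidence of ordered
faces of `Z` persists as a `B_{t'}`-incidence, every member is effective, and the period class is
continuous. [cite: Zharkov2020TropicalWeil, p. 3] [cite: MikhalkinZharkov2014Eigenwave, Def. 4.2] -/
theorem stub_formalFamily :
    ∀ t : Fin 5 → ℝ, t ∈ ksPosCone → LinearIndependent ℚ t →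
      ∀ Z : TropicalTorus.Chain ℝ 8 2, Z.IsCycle (ksMatrix t) → Z.Effective →
        ∃ U : Set (Fin 5 → ℝ), IsOpen U ∧ IsPreconnected U ∧ t ∈ U ∧ U ⊆ ksPosCone ∧
          ∃ cell : (Fin 5 → ℝ) → Fin Z.size → TropicalTorus.Cell ℝ 8 2,
            cell t = Z.cell ∧
            (∀ t' c, (cell t' c).dir = (Z.cell c).dir ∧ (cell t' c).weight = (Z.cell c).weight) ∧
            (∀ t' ∈ U, ∀ (c c' : Fin Z.size) (i i' : Fin 3) (π π' : Equiv.Perm (Fin 2)),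
              TropicalTorus.IsTranslate (ksMatrix t) ((Z.cell c).face i ∘ π) ((Z.cell c').face i' ∘ π') →
                TropicalTorus.IsTranslate (ksMatrix t') ((cell t' c).face i ∘ π) ((cell t' c').face i' ∘ π')) ∧
            (∀ t' ∈ U, (⟨Z.size, cell t'⟩ : TropicalTorus.Chain ℝ 8 2).Effective) ∧
            ContinuousOn (fun t' => TropicalTorus.compound 2 (ksMatrix t')⁻¹ *
              (⟨Z.size, cell t'⟩ : TropicalTorus.Chain ℝ 8 2).classOf) U :=
  fun t ht hli Z _ hZe => formalFamily t ht hli Z hZe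

end Summit.HodgeConjecture.HodgeConjecture.Theorems.FormalCycleCriterion

end
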